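import Summits.BirchSwinnertonDyer.BirchSwinnertonDyer.Theorems.ResidualThetaTransportAtTwoHeckeThetaPartnerAdicAtTwoTraceParity
import HarnessLib

/-!
# The trace congruence `a_ℓ(θ_ψ) ≡ a_ℓ(W)` modulo the maximal ideal of `ℤ̄₂` (split and inert primes)

Route `ResidualThetaTransportAtTwo`, crux K0⁺ `HeckeThetaPartnerAdicAtTwo` (stmt-BirchSwinnertonDyer-20690),
helper §AP of the line "proof from print", continuation of `…TraceParity.lean`.  THEOREMS ONLY (no
definition, no named fact, no `sorry`).

`trace_congr`: with the notation of `…TraceParity`, for an odd prime `ℓ ∤ Δ_min(W)` unramified in `k`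
and in `L`, and a function `ψ` on the primes of `k` with `ψ(w) ≡ χ(Frob_w)` (`2`-adically along
`e : ℚ̄₂ ≃ ℂ`) at the primes `w ∣ ℓ`:  `‖e⁻¹(∑_{Nw = ℓ} ψ(w)) - a_ℓ(W)‖ < 1`.
* split `(ℓ) = v·σv`: the primes of norm `ℓ` are exactly `v ≠ σv`, `Frob_{σv} = Frob_v⁻¹`
  (`galFrob_smul_eq_inv`), so the sum is `≡ ζ + ζ⁻¹`, `ζ = χ(Frob_v)` a cube root of unity; the roots
  of `h_W mod ℓ` are the fixed points of `Frob_v` on the three roots (`card_roots_hW_eq`): all three if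
  `Frob_v = 1` (then `ζ + ζ⁻¹ = 2` and `a_ℓ(W)` is even), none otherwise (`smul_ne_of_ne_one`; then
  `ζ ≠ 1` by injectivity, `ζ + ζ⁻¹ = -1`, and `a_ℓ(W)` is odd) — parity from `…Parity`;
* inert: no prime has norm `ℓ`, the sum is `0`, and `a_ℓ(W)` is even (`even_frobeniusTrace_of_inert`).

References: Serre, Invent. Math. 15 (1972) §5; Ribet, LNM 601 (1977) §3.
-/

set_option autoImplicit false
set_option linter.dupNamespace false

noncomputable section

open scoped NumberField Pointwise
open NumberField IsDedekindDomain Polynomial Module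
open Literature.NumberTheory.GaloisRepresentations Literature.NumberTheory.LFunctions
  Literature.NumberTheory.CubicFields Literature.NumberTheory.NumberFields
  Literature.NumberTheory.EllipticCurves Literature.NumberTheory.EllipticCurves.ModularForms

namespace Summit.BirchSwinnertonDyer.BirchSwinnertonDyer.Theorems.HeckeThetaPartner

variable {k : Type} [Field k] [NumberField k] [IsGalois ℚ k]
  (L : IntermediateField k (AlgebraicClosure k)) [FiniteDimensional k L] [IsGalois ℚ L]
  [IsAbelianGalois k L] [NumberField L]
  (W : WeierstrassCurve ℚ) [W.IsGloballyMinimal]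
  [hirr : Fact (Irreducible (MonicCubic.polyQ (WeierstrassCurve.integralModelInt W).b₂
    (8 * (WeierstrassCurve.integralModelInt W).b₄) (16 * (WeierstrassCurve.integralModelInt W).b₆)))]
  (ι : AdjoinRoot (MonicCubic.polyQ (WeierstrassCurve.integralModelInt W).b₂
    (8 * (WeierstrassCurve.integralModelInt W).b₄) (16 * (WeierstrassCurve.integralModelInt W).b₆)) →ₐ[ℚ] L)

omit [IsGalois ℚ k] in
/-- The absolute norm of `(ℓ)` in a quadratic field is `ℓ²`. [folklore] -/
theorem absNorm_span_natCast (hk : finrank ℚ k = 2) (ℓ : ℕ) :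
    Ideal.absNorm (Ideal.span {((ℓ : ℤ) : 𝓞 k)}) = ℓ ^ 2 := by
  rw [Ideal.absNorm_span_singleton, show ((ℓ : ℤ) : 𝓞 k) = algebraMap ℤ (𝓞 k) ℓ from by simp,
    Algebra.norm_algebraMap, RingOfIntegers.rank, hk]
  simp [Int.natAbs_pow]

omit [IsGalois ℚ k] in
/-- A prime of norm `ℓ` contains `ℓ`. [folklore] -/
theorem natCast_mem_of_absNorm_eq {ℓ : ℕ} {w : HeightOneSpectrum (𝓞 k)} (hw : Ideal.absNorm w.asIdeal = ℓ) :
    ((ℓ : ℤ) : 𝓞 k) ∈ w.asIdeal := by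
  have := Ideal.absNorm_mem w.asIdeal
  rw [hw] at this
  exact_mod_cast this

include ι in
open scoped Classical in
/-- **The trace congruence** `‖e⁻¹(∑_{Nw = ℓ} ψ(w)) - a_ℓ(W)‖ < 1` for an odd prime `ℓ ∤ Δ_min`
unramified in `k` and `L`, given `ψ(w) ≡ χ(Frob_w)` at the primes `w ∣ ℓ`.  See the module docstring.
[cite: SerreInventiones1972, §5.4] -/
theorem trace_congr (hk : finrank ℚ k = 2) (h3 : finrank k L = 3)
    (hKG : ¬ IsGalois ℚ (AdjoinRoot (MonicCubic.polyQ (WeierstrassCurve.integralModelInt W).b₂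
      (8 * (WeierstrassCurve.integralModelInt W).b₄) (16 * (WeierstrassCurve.integralModelInt W).b₆))))
    (hgen : (⨆ σ : AdjoinRoot (MonicCubic.polyQ (WeierstrassCurve.integralModelInt W).b₂
      (8 * (WeierstrassCurve.integralModelInt W).b₄) (16 * (WeierstrassCurve.integralModelInt W).b₆)) →ₐ[ℚ] L,
        σ.fieldRange) = ⊤)
    (χ : (L ≃ₐ[k] L) →* ℂˣ) (hχ : Function.Injective χ) (e : PadicAlgCl 2 ≃+* ℂ)
    (ψ : HeightOneSpectrum (𝓞 k) → ℂ)
    {ℓ : ℕ} [Fact ℓ.Prime] (hℓ2 : ℓ ≠ 2) (hℓΔ : ¬ (ℓ : ℤ) ∣ WeierstrassCurve.minimalDiscriminantInt W)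
    (hunrk : Algebra.IsUnramifiedIn (𝓞 k) (Ideal.span {(ℓ : ℤ)}))
    (hunrL : ∀ w : HeightOneSpectrum (𝓞 k), ((ℓ : ℤ) : 𝓞 k) ∈ w.asIdeal →
      Algebra.IsUnramifiedIn (𝓞 L) w.asIdeal)
    (hcong : ∀ w : HeightOneSpectrum (𝓞 k), ((ℓ : ℤ) : 𝓞 k) ∈ w.asIdeal →
      ‖e.symm (ψ w) - e.symm ((χ (galFrob k L w) : ℂˣ) : ℂ)‖ < 1) :
    ‖e.symm (∑ᶠ (w : HeightOneSpectrum (𝓞 k)) (_ : Ideal.absNorm w.asIdeal = ℓ), ψ w) -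
      (W.frobeniusTrace ℓ : PadicAlgCl 2)‖ < 1 := by
  classical
  have hℓ : ℓ.Prime := Fact.out
  haveI : IsGalois k L := by
    haveI : Normal k L := Normal.tower_top_of_normal ℚ k L
    haveI : Algebra.IsSeparable k L := Algebra.IsAlgebraic.isSeparable_of_perfectField
    exact IsGalois.mk
  -- the non-trivial automorphism `σ` of `k`, lifted to `τ ∈ Gal(L/ℚ)`
  obtain ⟨τ, hτ⟩ := exists_restrictNormal_ne_one L hk
  set σ := τ.restrictNormal k with hσdef
  -- a prime `v ∣ ℓ` of `k`
  have hℓ0 : ((ℓ : ℤ) : 𝓞 k) ≠ 0 := by exact_mod_cast hℓ.ne_zero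
  have hℓnu : ¬ IsUnit ((ℓ : ℤ) : 𝓞 k) := by
    intro hu
    have := hu.map (Algebra.norm ℤ)
    rw [show ((ℓ : ℤ) : 𝓞 k) = algebraMap ℤ (𝓞 k) ℓ from by simp, Algebra.norm_algebraMap,
      Int.isUnit_iff_natAbs_eq, Int.natAbs_pow, Int.natAbs_natCast, RingOfIntegers.rank, hk] at this
    exact hℓ.one_lt.ne' (by nlinarith [hℓ.one_lt, this])
  obtain ⟨P, hPmax, hℓP⟩ := Ideal.exists_le_maximal (Ideal.span {((ℓ : ℤ) : 𝓞 k)})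
    (by rw [Ne, Ideal.span_singleton_eq_top]; exact hℓnu)
  have hP0 : P ≠ ⊥ := fun h => hℓ0 (by
    have := hℓP (Ideal.mem_span_singleton_self _); rw [h] at this; exact this)
  let v : HeightOneSpectrum (𝓞 k) := ⟨P, hPmax.isPrime, hP0⟩
  have hℓv : ((ℓ : ℤ) : 𝓞 k) ∈ v.asIdeal := hℓP (Ideal.mem_span_singleton_self _)
  -- the set of primes of norm `ℓ`
  have finsum_eq : ∀ S : Set (HeightOneSpectrum (𝓞 k)), {w | Ideal.absNorm w.asIdeal = ℓ} = S →
      (∑ᶠ (w : HeightOneSpectrum (𝓞 k)) (_ : Ideal.absNorm w.asIdeal = ℓ), ψ w) = ∑ᶠ w ∈ S, ψ w := by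
    intro S hS; rw [← hS]; rfl
  have hN : Ideal.absNorm (Ideal.span {((ℓ : ℤ) : 𝓞 k)}) = ℓ ^ 2 := absNorm_span_natCast hk ℓ
  rcases span_natCast_eq_of_isUnramifiedIn hk σ hτ hℓ hunrk v hℓv with ⟨hfix, hspan⟩ | ⟨hne, hspan⟩
  · /- inert: no prime of norm `ℓ`, `a_ℓ(W)` even -/
    have hS : {w : HeightOneSpectrum (𝓞 k) | Ideal.absNorm w.asIdeal = ℓ} = ∅ := by
      ext w
      simp only [Set.mem_setOf_eq, Set.mem_empty_iff_false, iff_false]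
      intro hw
      have hle : v.asIdeal ≤ w.asIdeal := by
        rw [← hspan, Ideal.span_singleton_le_iff_mem]; exact natCast_mem_of_absNorm_eq hw
      have heq : v = w := HeightOneSpectrum.ext (v.isMaximal.eq_of_le w.isPrime.ne_top hle)
      rw [← heq, ← hspan, hN] at hw
      have : ℓ ^ 2 = ℓ ^ 1 := by rw [hw, pow_one]
      exact absurd (Nat.pow_right_injective hℓ.two_le this) (by norm_num)
    rw [finsum_eq ∅ hS, finsum_mem_empty, map_zero, zero_sub, norm_neg]
    have heven := even_frobeniusTrace_of_inert L W ι hk h3 hKG hgen hℓ2 hℓΔ v hspan.symm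
    exact norm_intCast_lt_one_of_even heven
  · /- split: `(ℓ) = v σv` -/
    -- norms
    have hNv : Ideal.absNorm v.asIdeal = ℓ ∧ Ideal.absNorm (σ • v).asIdeal = ℓ := by
      have hmul : Ideal.absNorm v.asIdeal * Ideal.absNorm (σ • v).asIdeal = ℓ ^ 2 := by
        rw [← map_mul, ← hspan, hN]
      have h1 : Ideal.absNorm v.asIdeal ≠ 1 := by
        rw [Ne, Ideal.absNorm_eq_one_iff]; exact v.isPrime.ne_top
      have h2 : Ideal.absNorm (σ • v).asIdeal ≠ 1 := by
        rw [Ne, Ideal.absNorm_eq_one_iff]; exact (σ • v).isPrime.ne_top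
      have hdvd : Ideal.absNorm v.asIdeal ∣ ℓ ^ 2 := Dvd.intro _ hmul
      obtain ⟨i, hi, hieq⟩ := (Nat.dvd_prime_pow hℓ).mp hdvd
      interval_cases i
      · rw [pow_zero] at hieq; exact absurd hieq h1
      · rw [pow_one] at hieq
        refine ⟨hieq, ?_⟩
        rw [hieq, pow_two] at hmul
        exact Nat.eq_of_mul_eq_mul_left hℓ.pos hmul
      · rw [hieq] at hmul
        have : Ideal.absNorm (σ • v).asIdeal = 1 := by
          have h := hmul; nth_rewrite 2 [← mul_one (ℓ ^ 2)] at h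
          exact Nat.eq_of_mul_eq_mul_left (pow_pos hℓ.pos 2) h
        exact absurd this h2
    have hS : {w : HeightOneSpectrum (𝓞 k) | Ideal.absNorm w.asIdeal = ℓ} = {v, σ • v} := by
      ext w
      simp only [Set.mem_setOf_eq, Set.mem_insert_iff, Set.mem_singleton_iff]
      constructor
      · intro hw
        have hle : v.asIdeal * (σ • v).asIdeal ≤ w.asIdeal := by
          rw [← hspan, Ideal.span_singleton_le_iff_mem]; exact natCast_mem_of_absNorm_eq hw
        rcases (Ideal.IsPrime.mul_le w.isPrime).mp hle with h | h
        · exact Or.inl (HeightOneSpectrum.ext (v.isMaximal.eq_of_le w.isPrime.ne_top h)).symm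
        · exact Or.inr (HeightOneSpectrum.ext ((σ • v).isMaximal.eq_of_le w.isPrime.ne_top h)).symm
      · rintro (rfl | rfl)
        · exact hNv.1
        · exact hNv.2
    have hne' : v ≠ σ • v := fun h => hne h.symm
    rw [finsum_eq _ hS, finsum_mem_pair hne']
    -- the cube root of unity `ζ = χ(Frob_v)` and `χ(Frob_{σv}) = ζ⁻¹`
    have hℓσv : ((ℓ : ℤ) : 𝓞 k) ∈ (σ • v).asIdeal := by
      have : (σ • v).asIdeal ∣ Ideal.span {((ℓ : ℤ) : 𝓞 k)} := by rw [hspan]; exact Dvd.intro_left _ rfl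
      exact (Ideal.dvd_span_singleton).mp this
    have hinv : galFrob k L (σ • v) = (galFrob k L v)⁻¹ :=
      galFrob_smul_eq_inv L hk h3 hKG ι hτ (hunrL _ hℓσv)
    set g := galFrob k L v with hgdef
    set ζ : ℂ := ((χ g : ℂˣ) : ℂ) with hζdef
    have hcard : Nat.card (L ≃ₐ[k] L) = 3 := by rw [IsGalois.card_aut_eq_finrank, h3]
    have hζ3 : ζ ^ 3 = 1 := by
      rw [hζdef, ← Units.val_pow_eq_pow_val, ← map_pow, ← hcard, pow_card_eq_one', map_one, Units.val_one]
    have hζ0 : ζ ≠ 0 := Units.ne_zero _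
    have hχσ : ((χ (galFrob k L (σ • v)) : ℂˣ) : ℂ) = ζ⁻¹ := by
      rw [hinv, map_inv, Units.val_inv_eq_inv_val]
    -- Dedekind's count through the arithmetic Frobenius `Frob_v`
    obtain ⟨Q, hQ, hfrob⟩ := galFrob_spec k L v
    haveI := hQ.1
    haveI := hQ.2
    have hQ0 : Q ≠ ⊥ := Ideal.ne_bot_of_mem_primesOver v.ne_bot hQ
    haveI : Q.IsMaximal := hQ.1.isMaximal hQ0
    have hℓQ : (ℓ : 𝓞 L) ∈ Q := by
      have : algebraMap (𝓞 k) (𝓞 L) ((ℓ : ℤ) : 𝓞 k) ∈ Q := by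
        rw [← Ideal.mem_comap]
        have h := hQ.2.over
        rw [Ideal.under] at h
        rw [← h]; exact hℓv
      simpa using this
    have hcardv : Nat.card (𝓞 k ⧸ Q.under (𝓞 k)) = ℓ := by
      rw [← hQ.2.over, ← Submodule.cardQuot_apply, ← Ideal.absNorm_apply]; exact hNv.1
    have hφ : ∀ x : 𝓞 L, g • x - x ^ ℓ ∈ Q := fun x => by
      have := hfrob x
      rwa [hcardv] at this
    have hded := card_roots_hW_eq L W ι Q hℓ2 hℓΔ hℓQ (MulSemiringAction.toRingHom _ (𝓞 L) g)
      (fun x => by rw [MulSemiringAction.toRingHom_apply]; exact hφ x)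
    have heven := even_frobeniusTrace_add_one_add_card_roots W hℓ2 hℓΔ
    rw [hded] at heven
    obtain ⟨hrcard, hrnodup⟩ := card_roots_ringOfIntegers_eq_three _ _ _ L ι
    set R := ((MonicCubic.poly (WeierstrassCurve.integralModelInt W).b₂
      (8 * (WeierstrassCurve.integralModelInt W).b₄) (16 * (WeierstrassCurve.integralModelInt W).b₆)).map
        (Int.castRingHom (𝓞 L))).roots with hRdef
    -- the algebraic identity behind the estimate
    have key : e.symm (ψ v + ψ (σ • v)) - (W.frobeniusTrace ℓ : PadicAlgCl 2) =
        (e.symm (ψ v) - e.symm ζ) + (e.symm (ψ (σ • v)) - e.symm ζ⁻¹) +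
          (e.symm (ζ + ζ⁻¹) - (W.frobeniusTrace ℓ : PadicAlgCl 2)) := by
      rw [map_add, map_add]; ring
    rw [key]
    refine norm_add_add_lt_one (hcong v hℓv) (by rw [← hχσ]; exact hcong _ hℓσv) ?_
    by_cases hg1 : g = 1
    · -- `Frob_v = 1`: all three roots fixed, `a_ℓ` even, `ζ = 1`
      have hfilter : (R.toFinset.filter (fun θ => (MulSemiringAction.toRingHom _ (𝓞 L) g) θ = θ)).card = 3 := by
        rw [Finset.filter_true_of_mem, Multiset.toFinset_card_of_nodup hrnodup, hrcard]
        intro θ _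
        rw [MulSemiringAction.toRingHom_apply, hg1, one_smul]
      rw [hfilter] at heven
      have hζ1 : ζ = 1 := by rw [hζdef, hg1, map_one, Units.val_one]
      rw [hζ1, inv_one, show (1 : ℂ) + 1 = ((2 : ℤ) : ℂ) by norm_num, map_intCast, ← Int.cast_sub]
      refine norm_intCast_lt_one_of_even ?_
      have : Even (W.frobeniusTrace ℓ + 4) := by simpa [add_assoc] using heven
      rw [Int.even_add] at this
      have h4 : Even (4 : ℤ) := ⟨2, rfl⟩
      exact (Int.even_sub).mpr ⟨fun _ => this.mpr h4, fun _ => ⟨1, rfl⟩⟩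
    · -- `Frob_v ≠ 1`: no root fixed, `a_ℓ` odd, `ζ ≠ 1`
      have hfilter : (R.toFinset.filter (fun θ => (MulSemiringAction.toRingHom _ (𝓞 L) g) θ = θ)).card = 0 := by
        rw [Finset.card_eq_zero, Finset.filter_eq_empty_iff]
        intro θ hθ
        rw [MulSemiringAction.toRingHom_apply]
        exact smul_ne_of_ne_one L _ _ _ hk h3 g hg1 (Multiset.mem_toFinset.mp hθ)
      rw [hfilter] at heven
      have hζ1 : ζ ≠ 1 := by
        intro h
        apply hg1
        apply hχ
        rw [map_one]
        exact Units.val_injective (by rw [← hζdef, h, Units.val_one])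
      rw [add_inv_eq_neg_one_of_pow_three hζ3 hζ1, show (-1 : ℂ) = ((-1 : ℤ) : ℂ) by norm_num, map_intCast,
        ← Int.cast_sub]
      refine norm_intCast_lt_one_of_even ?_
      have : Even (W.frobeniusTrace ℓ + 1) := by simpa using heven
      have h' : (-1 : ℤ) - W.frobeniusTrace ℓ = -(W.frobeniusTrace ℓ + 1) := by ring
      rw [h']
      exact this.neg

end Summit.BirchSwinnertonDyer.BirchSwinnertonDyer.Theorems.HeckeThetaPartner

end
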